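import Literature.Analysis.FluidPDE.ExtremeGrowthSupNormAPriori
import Literature.Analysis.FunctionSpaces.TorusSupNormContinuity
import HarnessLib

/-!
# `u ∈ L¹(a,b;L^∞)` and `Δu (1+‖∇u‖₂²)⁻¹ ∈ L²(a,b;L²)` with explicit bounds on `T³`:
# the integrated Foias–Guillopé–Temam estimates

Analysis/FluidPDE file, a short corollary file of `ExtremeGrowthSupNormAPriori.lean`.

Robinson–Rodrigo–Sadowski 2016, Lemma 8.15 (after Foias–Guillopé–Temam 1981): a Leray–Hopf
weak solution of the Navier–Stokes equations on the torus satisfies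
`∫₀ᵀ ‖Δu‖₂² / ‖∇u‖₂⁴ dt < ∞` on the set where `∇u ≠ 0` ((8.6)) and `u ∈ L¹(0,T;L^∞)` ((8.7)).
The sibling file proves, for CLASSICAL mean-zero solutions of the unforced system on `T^d`
(`card d = 3`, `ν > 0`) on a window `[a, b]`, the slice inequalities
`ν‖Δu‖₂² ≤ (Ψ' + c_ν‖∇u‖₂²)(1 + ‖∇u‖₂²)²` (`Ψ = (1+‖∇u‖₂²)⁻¹`, `c_ν = 27/(4π⁴ν³)`) and
`‖u(t,x)‖ ≤ fgtSupBound ν (u t) = d/dt fgtSupPrimitive ν u (t)`, with primitives whose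
increments over `[a, b]` are explicit. Here we integrate them in time (the integrands are
continuous in `t` for jointly smooth fields — `Torus.IsSmoothSpaceTimeOn.continuousOn_integral`,
`Torus.IsSmoothSpaceTimeOn.continuousOn_toReal_eSupNorm` — and a continuous `N ≤ R'` integrates
to `∫ₐᵇ N ≤ R(b) − R(a)`, `intervalIntegral_le_sub_of_le_hasDerivWithinAt`):

* `integral_dissipationRatio_le_sub` / `integral_dissipationRatio_le` — **(8.6), explicit**:
  `∫ₐᵇ ν‖Δu‖₂²/(1+‖∇u‖₂²)² dt ≤ Ψ(b) − Ψ(a) + (c_ν/ν)(K(u(a)) − K(u(b))) ≤ 1 + (c_ν/ν) K(u(a))`;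
* `toReal_eSupNorm_le_fgtSupBound` — `‖v‖_{L^∞} ≤ fgtSupBound ν v` for smooth mean-zero `v`;
* `integral_toReal_eSupNorm_le_fgtSupPrimitive_sub` / `integral_toReal_eSupNorm_le` —
  **(8.7), explicit**: `∫ₐᵇ ‖u(t)‖_{L^∞} dt ≤ α_ν + β (b − a) + (γ_ν/ν) K(u(a))`
  (`α_ν = √2/(4πν)`, `β = 3√2/(4π)`, `γ_ν = 27√2/(16π⁵ν⁴) + 3√2/(4π)`).

The weak-solution generality (epochs of regularity) is NOT covered; nothing here concerns any
particular flow.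

## References

* C. Foias, C. Guillopé, R. Temam, Comm. PDE 6 (1981) 329–359. [FoiasGuillopeTemam1981]
* J. C. Robinson, J. L. Rodrigo, W. Sadowski, CUP 2016, Lemma 8.15, (8.6)–(8.7). [RobinsonRodrigoSadowskiCUP2016]
-/

noncomputable section

open Set MeasureTheory Real intervalIntegral
open scoped InnerProductSpace RealInnerProductSpace ENNReal

namespace Literature.Analysis.FluidPDE

open Literature.Analysis.FunctionSpaces

variable {d : Type*} [Fintype d] [DecidableEq d]

omit [Fintype d] [DecidableEq d] in
/-- **A continuous function below a derivative integrates below the increment**: if `N` is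
continuous on `[a, b]`, `R` has one-sided derivative `R'(s)` within `[a, b]` at every `s`, and
`N ≤ R'` on `[a, b]`, then `∫ₐᵇ N ≤ R(b) − R(a)` (`∫ₐᵗ N − R` is nonincreasing; no integrability
of `R'` is needed). The integration step of the a priori estimates.
[cite: RobinsonRodrigoSadowskiCUP2016, Lemma 8.15 (proof, integration in time)] -/
theorem intervalIntegral_le_sub_of_le_hasDerivWithinAt {a b : ℝ} (hab : a < b) {N R R' : ℝ → ℝ}
    (hN : ContinuousOn N (Icc a b)) (hR : ∀ s ∈ Icc a b, HasDerivWithinAt R (R' s) (Icc a b) s)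
    (hle : ∀ s ∈ Icc a b, N s ≤ R' s) : ∫ t in a..b, N t ≤ R b - R a := by
  have hIder : ∀ s ∈ Icc a b,
      HasDerivWithinAt (fun r => ∫ t in a..r, N t) (N s) (Icc a b) s := by
    intro s hs
    haveI : Fact (s ∈ Icc a b) := ⟨hs⟩
    have hint : IntervalIntegrable N volume a s :=
      (hN.mono (Icc_subset_Icc_right hs.2)).intervalIntegrable_of_Icc hs.1
    exact integral_hasDerivWithinAt_right hint
      (hN.stronglyMeasurableAtFilter_nhdsWithin measurableSet_Icc s) (hN s hs)
  set Q : ℝ → ℝ := fun r => (∫ t in a..r, N t) - R r with hQdef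
  have hQ : ∀ s ∈ Icc a b, HasDerivWithinAt Q (N s - R' s) (Icc a b) s :=
    fun s hs => (hIder s hs).sub (hR s hs)
  have hanti : AntitoneOn Q (Icc a b) := by
    refine antitoneOn_of_hasDerivWithinAt_nonpos (convex_Icc a b)
      (fun s hs => (hQ s hs).continuousWithinAt)
      (fun s hs => (hQ s (interior_subset hs)).mono interior_subset) fun s hs => ?_
    have := hle s (interior_subset hs)
    linarith
  have hcmp : Q b ≤ Q a := hanti (left_mem_Icc.2 hab.le) (right_mem_Icc.2 hab.le) hab.le
  rw [hQdef] at hcmp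
  simp only [integral_same, zero_sub] at hcmp
  linarith

variable {ν a b : ℝ} {u : ℝ → UnitAddTorus d → EuclideanSpace ℝ d} {p : ℝ → UnitAddTorus d → ℝ}

/-! ## (8.6): the weighted dissipation is integrable, with an explicit bound -/

/-- **(8.6) with explicit constants**: along a classical mean-zero solution of the unforced
Navier–Stokes equations on `T³` (`ν > 0`) on `[a, b]`,
`∫ₐᵇ ν‖Δu(t)‖₂² / (1 + ‖∇u(t)‖₂²)² dt ≤ (Ψ(u(b)) − Ψ(u(a))) + (c_ν/ν)(K(u(a)) − K(u(b)))`,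
`Ψ = (1+‖∇u‖₂²)⁻¹`, `c_ν = 27/(4π⁴ν³)` (integrate `ν‖Δu‖₂²/(1+‖∇u‖₂²)² ≤ Ψ' + c_ν‖∇u‖₂²`
and `K' = −ν‖∇u‖₂²`). [cite: RobinsonRodrigoSadowskiCUP2016, Lemma 8.15, (8.6)] [cite: FoiasGuillopeTemam1981, main a priori estimate] -/
theorem integral_dissipationRatio_le_sub (hd : Fintype.card d = 3) (hν : 0 < ν) (hab : a < b)
    (h : Torus.IsClassicalNSSolutionOn (Icc a b) ν 0 u p)
    (hmean : ∀ t ∈ Icc a b, Torus.HasZeroMean (u t)) :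
    ∫ t in a..b, ν * (∫ x, ‖Torus.laplacian (u t) x‖ ^ 2) / (1 + Torus.gradNormSq (u t)) ^ 2 ≤
      (fgtPotential (u b) - fgtPotential (u a)) +
        fgtRateConst ν / ν * (Torus.kineticEnergy (u a) - Torus.kineticEnergy (u b)) := by
  have hS : UniqueDiffOn ℝ (Icc a b) := uniqueDiffOn_Icc hab
  -- continuity of the integrand
  have hΔ := h.smooth_velocity.laplacian hS
  have hD : ContinuousOn (fun t => ∫ x, ‖Torus.laplacian (u t) x‖ ^ 2) (Icc a b) := by
    have hc := (hΔ.inner hΔ).continuousOn_integral (convex_Icc a b)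
    refine hc.congr fun t _ => ?_
    simp only [real_inner_self_eq_norm_sq]
  have hG : ContinuousOn (fun t => Torus.gradNormSq (u t)) (Icc a b) :=
    fun t ht => (hasDerivWithinAt_gradNormSq_of_solution hab h ht).continuousWithinAt
  have hden : ∀ t ∈ Icc a b, (1 + Torus.gradNormSq (u t)) ^ 2 ≠ 0 := fun t _ => by
    have := Torus.gradNormSq_nonneg (u t)
    positivity
  have hN : ContinuousOn
      (fun t => ν * (∫ x, ‖Torus.laplacian (u t) x‖ ^ 2) / (1 + Torus.gradNormSq (u t)) ^ 2)
      (Icc a b) :=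
    (continuousOn_const.mul hD).div ((continuousOn_const.add hG).pow 2) hden
  -- the primitive `R = Ψ − (c_ν/ν) K` and its derivative `Ψ' + c_ν ‖∇u‖₂²`
  have hR : ∀ s ∈ Icc a b, HasDerivWithinAt
      (fun r => fgtPotential (u r) - fgtRateConst ν / ν * Torus.kineticEnergy (u r))
      (fgtPotentialRate ν (u s) + fgtRateConst ν * Torus.gradNormSq (u s)) (Icc a b) s := by
    intro s hs
    have h1 := (hasDerivWithinAt_fgtPotential_of_solution hab h hs).sub
      ((hasDerivWithinAt_kineticEnergy_of_solution h hs).const_mul (fgtRateConst ν / ν))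
    refine h1.congr_deriv ?_
    field_simp
    ring
  have hle : ∀ s ∈ Icc a b,
      ν * (∫ x, ‖Torus.laplacian (u s) x‖ ^ 2) / (1 + Torus.gradNormSq (u s)) ^ 2 ≤
        fgtPotentialRate ν (u s) + fgtRateConst ν * Torus.gradNormSq (u s) := by
    intro s hs
    have hpos : 0 < (1 + Torus.gradNormSq (u s)) ^ 2 := by
      have := Torus.gradNormSq_nonneg (u s)
      positivity
    rw [div_le_iff₀ hpos]
    exact nu_mul_integral_norm_laplacian_sq_le hd hν (h.smooth_velocity.isSmooth_slice hs)
      (hmean s hs)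
  have key := intervalIntegral_le_sub_of_le_hasDerivWithinAt hab hN hR hle
  linarith

/-- **(8.6), uniform form**: `∫ₐᵇ ν‖Δu(t)‖₂²/(1+‖∇u(t)‖₂²)² dt ≤ 1 + (c_ν/ν) K(u(a))`,
`c_ν = 27/(4π⁴ν³)`, along a classical mean-zero solution of the unforced Navier–Stokes
equations on `T³` (`ν > 0`). [cite: RobinsonRodrigoSadowskiCUP2016, Lemma 8.15, (8.6)] [cite: FoiasGuillopeTemam1981, main a priori estimate] -/
theorem integral_dissipationRatio_le (hd : Fintype.card d = 3) (hν : 0 < ν) (hab : a < b)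
    (h : Torus.IsClassicalNSSolutionOn (Icc a b) ν 0 u p)
    (hmean : ∀ t ∈ Icc a b, Torus.HasZeroMean (u t)) :
    ∫ t in a..b, ν * (∫ x, ‖Torus.laplacian (u t) x‖ ^ 2) / (1 + Torus.gradNormSq (u t)) ^ 2 ≤
      1 + fgtRateConst ν / ν * Torus.kineticEnergy (u a) := by
  have h1 := integral_dissipationRatio_le_sub hd hν hab h hmean
  have hΨb := fgtPotential_le_one (u b)
  have hΨa := fgtPotential_pos (u a)
  have hKb := Torus.kineticEnergy_nonneg (u b)
  have hc : 0 ≤ fgtRateConst ν / ν := div_nonneg (fgtRateConst_nonneg hν) hν.le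
  nlinarith [mul_nonneg hc hKb]

/-! ## (8.7): `u ∈ L¹(a,b;L^∞)`, with an explicit bound -/

/-- **`‖v‖_{L^∞} ≤ fgtSupBound ν v`** for a smooth mean-zero field on `T³` (`ν > 0`): the sup
norm `(eSupNorm v).toReal` is bounded by the pointwise Foias–Guillopé–Temam majorant.
[cite: RobinsonRodrigoSadowskiCUP2016, Lemma 8.15, (8.7)] -/
theorem toReal_eSupNorm_le_fgtSupBound (hd : Fintype.card d = 3) (hν : 0 < ν)
    {v : UnitAddTorus d → EuclideanSpace ℝ d} (hv : Torus.IsSmooth v) (h0 : Torus.HasZeroMean v) :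
    (eSupNorm v).toReal ≤ fgtSupBound ν v := by
  have hB : 0 ≤ fgtSupBound ν v :=
    (norm_nonneg (v 0)).trans (norm_le_fgtSupBound hd hν hv h0 0)
  refine ENNReal.toReal_le_of_le_ofReal hB (iSup_le fun x => ?_)
  rw [← ofReal_norm]
  exact ENNReal.ofReal_le_ofReal (norm_le_fgtSupBound hd hν hv h0 x)

/-- **`∫ₐᵇ ‖u(t)‖_{L^∞} dt ≤ P(b) − P(a)`**, `P = fgtSupPrimitive ν u`, along a classical
mean-zero solution of the unforced Navier–Stokes equations on `T³` (`ν > 0`) on `[a, b]`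
(`t ↦ ‖u(t)‖_{L^∞}` is continuous and `‖u(t)‖_{L^∞} ≤ P'(t)`).
[cite: RobinsonRodrigoSadowskiCUP2016, Lemma 8.15, (8.7)] [cite: FoiasGuillopeTemam1981, main a priori estimate] -/
theorem integral_toReal_eSupNorm_le_fgtSupPrimitive_sub (hd : Fintype.card d = 3) (hν : 0 < ν)
    (hab : a < b) (h : Torus.IsClassicalNSSolutionOn (Icc a b) ν 0 u p)
    (hmean : ∀ t ∈ Icc a b, Torus.HasZeroMean (u t)) :
    ∫ t in a..b, (eSupNorm (u t)).toReal ≤ fgtSupPrimitive ν u b - fgtSupPrimitive ν u a :=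
  intervalIntegral_le_sub_of_le_hasDerivWithinAt hab h.smooth_velocity.continuousOn_toReal_eSupNorm
    (fun _ hs => hasDerivWithinAt_fgtSupPrimitive hν hab h hs) fun s hs =>
    toReal_eSupNorm_le_fgtSupBound hd hν (h.smooth_velocity.isSmooth_slice hs) (hmean s hs)

/-- **`u ∈ L¹(a,b;L^∞)` with an explicit bound ((8.7) for classical solutions on `T³`)**:
`∫ₐᵇ ‖u(t)‖_{L^∞} dt ≤ α_ν + β (b − a) + (γ_ν/ν) K(u(a))`, i.e.
`≤ √2/(4πν) + 3√2 (b − a)/(4π) + (27√2/(16π⁵ν⁵) + 3√2/(4πν)) K(u(a))`, along a classical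
mean-zero solution of the unforced Navier–Stokes equations (`ν > 0`) on `[a, b]`.
[cite: RobinsonRodrigoSadowskiCUP2016, Lemma 8.15, (8.7)] [cite: FoiasGuillopeTemam1981, main a priori estimate] -/
theorem integral_toReal_eSupNorm_le (hd : Fintype.card d = 3) (hν : 0 < ν) (hab : a < b)
    (h : Torus.IsClassicalNSSolutionOn (Icc a b) ν 0 u p)
    (hmean : ∀ t ∈ Icc a b, Torus.HasZeroMean (u t)) :
    ∫ t in a..b, (eSupNorm (u t)).toReal ≤
      fgtRateCoeff ν + fgtConstCoeff * (b - a) + fgtGradCoeff ν / ν * Torus.kineticEnergy (u a) :=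
  (integral_toReal_eSupNorm_le_fgtSupPrimitive_sub hd hν hab h hmean).trans
    (fgtSupPrimitive_sub_le (u := u) hν (right_mem_Icc.2 hab.le))

end Literature.Analysis.FluidPDE
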